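import Literature.NumberTheory.EllipticCurves.KubertTateFourteen
import Literature.NumberTheory.EllipticCurves.X1FourteenMordellWeil
import HarnessLib

/-!
# No elliptic curve over `ℚ` has a rational point of order `14` (Kubert 1976, Ch. IV: the case
# `m = 14` of Mazur's Thm. (7'))

Topic `NumberTheory/EllipticCurves`; the proofs file combining

* `KubertTateFourteen` — over any field of characteristic `≠ 2`, a nonsingular point of order `14`
  on a Weierstrass cubic yields, through the Tate normal form, Sutherland's raw model `F₁₄(r,s) = 0`
  of `X₁(14)` and the inverse of his birational map, a point `(u, v)` of
  `V : v² = u³ - 11u² + 32u` (`= 14A4`) with `u ∉ {0, 4, 8}`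
  (`not_exists_addOrderOf_eq_fourteen_of_X1Fourteen_points`);
* `X1FourteenMordellWeil` — `V(ℚ)` consists of the six points with `u ∈ {0, 4, 8}` (rank `0` by
  descent via `2`-isogeny and Mordell–Weil; torsion `ℤ/6` by `p`-adic integrality), i.e. of the six
  rational cusps of `X₁(14)` (`X1Fourteen_points`),

into the theorem over `ℚ` (everything PROVED, no named fact, no definition):

* **`not_exists_addOrderOf_eq_fourteen`** — no Weierstrass curve over `ℚ` (elliptic or not) has a
  nonsingular rational point of order `14`; in Mazur's wording (Thm. (7'): "`m ≤ 10` or `m = 12`")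
  the case `m = 14`, which his First reduction (Ch. III §5, p. 156) takes from Kubert 1976, Ch. IV,
  where `X₁(14)(ℚ)` is shown to be cuspidal;
* `not_exists_injective_zmod_fourteen` — equivalently, `ℤ/14 ↪̸ E(ℚ)`.

The consumer on Ribet's side (`(⋆₇)` of `RationalTwoTorsionSemistableModPIrreduciblePerPrimeProofs`:
no `E/ℚ` with rational `P₁ ≠ P₂` of order `2` and `Q` of order `7`, via `noTwoTorsionPrime_seven_of`)
is served in `Literature/NumberTheory/DiophantineGeometry/GeneralizedFermatTwoPowerCoefficientMazurThirteenStepThreeProofs.lean`.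

## References

* [Kubert1976] D. S. Kubert, *Universal bounds on the torsion of elliptic curves*, Proc. London
  Math. Soc. (3) 33 (1976) 193–237, Ch. IV (rational points of `X₁(N)`, `N` composite; `N = 14`).
* [Mazur1977] B. Mazur, *Modular curves and the Eisenstein ideal*, Publ. Math. IHÉS 47 (1977),
  Thm. (7') p. 35 and Ch. III §5, p. 156 (First reduction).
* [Sutherland2012] A. V. Sutherland, Math. Comp. 81 (2012) 1131–1147, §2, §4 (Tables, `N = 14`).
* [Ribet1997] K. A. Ribet, Acta Arith. 79 (1997) 7–16, Prop. 1 (p. 11–12).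
-/

noncomputable section

namespace Literature.NumberTheory.EllipticCurves

open _root_.WeierstrassCurve

/-- **No rational point of order `14` (Kubert 1976, Ch. IV; the case `m = 14` of Mazur's Thm. (7')).**
No Weierstrass curve over `ℚ` has a nonsingular rational point of order `14`: such a point would
give (`KubertTateFourteen`: Tate normal form, Sutherland's raw form `F₁₄(r, s) = 0` of `X₁(14)`, the
inverse of his birational map) a rational point of `V : v² = u³ - 11u² + 32u` with `u ∉ {0, 4, 8}`,
but `V(ℚ)` is the six cusps `u ∈ {0, 4, 8}` (`X1Fourteen_points`: rank `0` by descent via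
`2`-isogeny, torsion `ℤ/6`). Stated for an arbitrary `DecidableEq ℚ` instance, as the group law of
`W.toAffine.Point` is. [cite: Kubert1976, Ch. IV (X₁(14)(ℚ) is cuspidal); Mazur1977, Thm. (7') p. 35 and Ch. III §5 p. 156; Sutherland2012, §4 Table "genus 1 cases" N = 14] -/
theorem not_exists_addOrderOf_eq_fourteen [DecidableEq ℚ] (W : WeierstrassCurve ℚ) :
    ¬ ∃ P : W.toAffine.Point, addOrderOf P = 14 :=
  not_exists_addOrderOf_eq_fourteen_of_X1Fourteen_points two_ne_zero
    (fun u v h => X1Fourteen_points u v h) W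

/-- **`ℤ/14ℤ` does not embed in `E(ℚ)`**: no injective additive homomorphism `ℤ/14 → W(ℚ)` for a
Weierstrass curve `W/ℚ` (the image of `1` would have order `14`). [cite: Kubert1976, Ch. IV (X₁(14)); Mazur1977, Thm. (8)] -/
theorem not_exists_injective_zmod_fourteen [DecidableEq ℚ] (W : WeierstrassCurve ℚ) :
    ¬ ∃ f : ZMod 14 →+ W.toAffine.Point, Function.Injective f := by
  rintro ⟨f, hf⟩
  refine not_exists_addOrderOf_eq_fourteen W ⟨f 1, ?_⟩
  rw [addOrderOf_injective f hf, ZMod.addOrderOf_one]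

end Literature.NumberTheory.EllipticCurves

end
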